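import Mathlib
import Literature.MathematicalPhysics.QuantumFieldTheory.MagnenRivasseauSeneor1993.MRS93HomotheticSmallBeta
import HarnessLib

/-!
# Magnen–Rivasseau–Sénéor, *Construction of YM₄ with an infrared cutoff* (CMP 155, 1993), §VI Lemma VI.2 (VI.20a/b) at the HOMOTHETIC
# gauge for the CROSS-ordered `BF` of (VI.9) — PROVED (every `0 < ζ ≤ 1`, in particular `ζ = 3/13`), in the regularised variables
# `(a, b) = (√(βκ), β)` of p.372

statement-level skeleton of published theorems with citation tags; proofs where landed; nothing here is a claim about the
Yang–Mills mass gap, about continuum YM₄ on T⁴, or about the Clay problem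

**Citation header (reproduction of PUBLISHED work).** J. Magnen, V. Rivasseau, R. Sénéor, *Construction of YM₄ with an infrared cutoff*,
Commun. Math. Phys. **155** (1993) 325–383 [MagnenRivasseauSeneor1993], Sect. VI pp.369–374 [PDF 45–50], App. 1 pp.378–383 [PDF 54–59]
(held scan `paper:magnen1993-cmp155-mrs-ym4-infrared-cutoff`, text layer p0048–p0050; page images `run/shared/lean/pub/lit-balaban/inprint/
lit-balaban-p14/renders-cmp155/p49_full_s6.png` (VI.17)–(VI.18), `p50_top_s2.png` (VI.19)–Lemma VI.2; `pub-balaban-gaps-mrs-lit-2/g4/renders/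
p59_crop_r250-2300_s2.png` p.383 tl.1–7). Cell pub-balaban-gaps (YM blitz, track G3), seat mrs-lit-2 (gen 5; gen 6: v1.1 = header re-quoted AS PRINTED + §6, v1.2 = one header formula corrected, v1.3 = §7 + provenance sentence
corrected; gen 7: v1.4 = one gloss de-guillemeted in «What is NOT claimed» — zero Lean change), file 21 of the seat; record
`run/shared/lean/pub/pub-balaban-gaps/g3/MRS-AS-PRINTED-estimates.md` §3 findings (n)–(o). Imports file 20 `MRS93HomotheticSmallBeta` (`BFreg`,
`BF12Cross_dict`, `smallBeta_pointwise`, `tau1_sphere`, `tau2_sphere`, `continuous_A1/B2`) and through it file 19 `MRS93HomotheticLargeBeta`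
(`crossDet`, `crossIntegrand`, `crossF`, `xOf`, `det_M3_dict`, `CLargeFrom`), file 18 (`det_transfer`, `BF12Cross`), file 9 (`angAvg`,
`angAvg_affine_A`, `angAvg_mono_of_continuous`, `angAvg_le_of_le_Ioo`, `feynmanCubic`, `feynmanIntegrand_le_largeBeta`), file 8
(`Stability.SmallBetaExpansion/MiddleRangeBound/LargeBetaLinear`, `lemmaVI2_at_of_inputs`) and `MRS93OneLoopCounterterms` (`OneLoop.firstOrder_assembly`).

**What the paper prints (verbatim, from the page images; v1.1 re-quotes this block AS PRINTED — v1's first item spliced two sentences that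
are NOT printed («Let us remark that we have in fact two possible choices for the gauge: … we find ζ = 3/13 or 13/3 …» and «Since κ, t, cosθ,
sinφ … using (VI.19) and …») into the p.374 quotation, and its second item quoted «Since the polynomial P has … we have not pushed further the
computation», of which «Since» and «we have not pushed further the computation» are not printed (0 hits in the text layer); all withdrawn here,
nothing typed depended on them. Provenance (v1.3, corrected): the p.374 splice is referee gen 12's NIT N-K (1) ([REF-G12-R8-LEMMAVI2-F21],
08:30Z), also found independently by the seat's gen-6 audit, which had not read that line when v1.1 was filed; the other fragments, and the
explicit «∫u du» sentence answering N-K (2), are the seat's; v1.1/v1.2 said «self-reported ahead of the referee's R8» — inaccurate, withdrawn).**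
* p.374 [PDF 50], text layer p0050 L2–9 (page image `renders-cmp155/p50_full_s6.png`, crop `p50_top_s2.png`): «If we restrict us to the region
  0 ≤ ζ ≤ 1, we have (β/2)(1 + t²)[−3ζ/2 − 1/2 − κ(2 − (3/2)ζ)] ≤ −(β/4)(1 + κ) ≤ −(β/4). (VI.19) Now using the fact that κ, t, cosθ, sinφ, ζ
  and ζ⁻¹ all vary in compact intervals (for ζ and ζ⁻¹ this is because we can restrict us to a small interval centered respectively around 3/13
  or 13/3), and the fact that the logarithms of explicit polynomials in β such as those of (VI.14) are bounded by a constant times β at large β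
  (uniform in κ, t, cosθ, sinφ, ζ and ζ⁻¹ by compactness) it is easy to check the following lemma:» **Lemma VI.2.** (p0050 L9–16) «If 0 ≤ ζ ≤ 1
  there exists two (large…) constants K₁ and K₂ such that (2/π)∫₀^{+π} sin²θ dθ (1/2)∫₀^{+π} sinφ dφ ln|1 − βκ[cos²θ + t²sin²θcos²φ]|
  − (1/2)ln(1 + βP(β, κ, t, cosθ, sinφ, ζ, 1/ζ)) + [∫u du(β/2)[6(1 + (1/ζ − 1)/4) − κ(4 + 3(1/ζ − 1)/2)](1 + t²)] ≤ K₂β if β ≥ (K₁)⁻¹ (VI.20a)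
  ≤ −(β/8) if β ≤ (K₁)⁻¹. (VI.20b)» (the typed integrand, as in files 9/19, carries the third bracket WITHOUT the printed «∫u du» — the
  `u`-integration belongs to the representation (VI.14) and is the `v`-integral of (VI.35), see §6 below and file 2 `Stability.dressingFactor_le_one`).
* p.374, p0050 L17–18 and L25–27 (same image; crop `p50_VI35_s2.png`): «We can then complete the proof of Lemma VI.1. Indeed we write (using the
  fact that β = κ/v and 0 ≤ κ ≤ 1 and using (III.7)): g_k(x) ≤ exp(|Δ|(x⁴[∫_{v<K₁} K₂βv dv − [∫v dv(β²/24)[(36 + 18(1/ζ − 1) + 7.5(1/ζ − 1)²)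
  − κ(90 + 45(1/ζ − 1) + 15(1/ζ − 1)²) + κ²(54 + 27(1/ζ − 1) + 7.5(1/ζ − 1)²)](1 + t²)²]])) ≤ exp(|Δ|x⁴[K₁K₂ − |log η|]) ≤ 1 (VI.35) if, again,
  we choose the parameter η in Sect. III sufficiently small so that |log η| ≥ K₁K₂. This achieves the proof of the lemma.»
* p.373 [PDF 49], p0049 L35–37: «We will prove Lemma VI.1 using a crude bound which follows form [sic] (VI.17) and the fact that the polynomial
  P has a fixed number of (in principle) computable coefficients.»; p.372 [PDF 48], p0048 L15–17: «β = κ_k(u)/v = x²M^{−2i}κ_k(u)/u (β is a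
  function of k, u and x), κ = κ_k(u) and y = tx, t ∈ [0,1].»
* The value ζ = 3/13 (loci AS PRINTED): p.332 [PDF 8], p0008 L38–40: «we pass to a particular gauge well suited for perturbation theory, which
  we call the homothetic gauge. It is defined exactly as the Feynman or Landau gauge but with a parameter, called λ in [IZ] and ζ in this
  paper, which takes a value close to 3/13»; p.333 [PDF 9], p0009 L1–3: «the one loop wave function renormalization is proportional to
  10/3 + (1 − 1/ζ), hence vanishes for ζ = 3/13 [IZ].» (= the tree's `OneLoop.waveFunctionCoeff`; seat crop `g6/renders/p09_crop_r250-700_s2.png` —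
  v1.1 of this header mis-transcribed the garbled text layer as «10/3 − 1/2(1 − 1/ζ)», corrected in v1.2); p.339 [PDF 15], p0015 L34: «ζ is the number close to 3/13 defining the homothetic
  [gauge]»; p.374 L4–6 as quoted above («a small interval centered respectively around 3/13 or 13/3»).

**What this file proves (kernel-checked; zero `sorry`, zero new `def … : Prop`).**
* `crossDetReg ζ β κ t θ φ := det BF_reg(ζ, ζ⁻¹; √(βκ), β; t, n(θ,φ))` (file 20's regularised dictionary), `crossIntegrandReg`, `crossFReg` — the
  left side of Lemma VI.2 for the cross-ordered homothetic BF WITHOUT file 19's `κ = 0` junk: `crossDetReg_eq_crossDet`, `crossFReg_eq_crossF`: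
  for `κ > 0` (and `0 < ζ`, `β ≥ 0`) they ARE file 19's `crossDet`, `crossF`; at `κ = 0` they are the continuous extension.
* `det_transfer_reg` (`0 < ζ ≤ 1`, `β ≥ 0`, `0 ≤ κ ≤ 1`): `ζ⁹·S⁴ ≤ det BF_reg(√(βκ), β)` — file 18's p.383 transfer in Lemma VI.2's variables,
  extended to `κ = 0` by continuity in `κ` (`ge_of_tendsto`); `crossIntegrandReg_le_feynman` (all `0 ≤ κ ≤ 1`).
* (H3), (H2) for `crossFReg` from any threshold `0 < a ≤ 1/4` with file 19's constant `CLargeFrom ζ a` (`largeBetaLinear_crossReg_from`,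
  `middleRangeBound_crossReg_from`; the angular log-sin majorant as in files 9/19).
* **(H1) PROVED**: `smallBetaExpansion_crossReg` (`0 < ζ ≤ 1`): `∃ β₀ ∈ (0, 1/4], C ≥ 0, Stability.SmallBetaExpansion crossFReg ζ β₀ C` — from
  file 20's uniform second-order bound `smallBeta_pointwise`, the sphere forms `tau1_sphere`/`tau2_sphere` (first order = file 10's (VI.17),
  common to both orderings, file 18 §6), `ln|1 − βκA| ≤ −βκA`, `angAvg_affine_A`, (VI.18) `OneLoop.firstOrder_assembly` and (VI.19).
* **`lemmaVI2_crossReg`** (`0 < ζ ≤ 1`) and **`lemmaVI2_cross_homothetic`** (`ζ = 3/13`): «there exists two constants K₁ and K₂ such that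
  [F] ≤ K₂β if β ≥ (K₁)⁻¹; ≤ −(β/8) if β ≤ (K₁)⁻¹» for `F = crossFReg`, all `β ≥ 0`, `κ, t ∈ [0,1]` — UNCONDITIONAL; `lemmaVI2_cross_pos`: the same
  for file 19's `crossF` on `κ > 0`.
* §6 (v1.1) **(VI.35) at the homothetic gauge with Lemma VI.2 DISCHARGED**: `dressingFactor_le_one_crossReg` (`0 < ζ ≤ 1`) and
  `dressingFactor_le_one_cross_homothetic` (`ζ = 3/13`) — file 2's kernel-checked assembly `Stability.dressingFactor_le_one` of the printed
  (VI.35) («g_k(x) ≤ … ≤ exp(|Δ|x⁴[K₁K₂ − |log η|]) ≤ 1 … if |log η| ≥ K₁K₂») with its two Lemma VI.2 hypotheses `h20a`/`h20b` supplied by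
  `lemmaVI2_crossReg` for `F = crossFReg(·, ·, t, ζ)`; what remains NAMED is exactly what the paper invokes and does not prove on p.374: the
  representation (VI.14) of `ln g` in the variables of p.372 (`hrep`, `hint`), «0 ≤ κ ≤ 1» (`hκ`), «using (III.7)» (`hCT : |log η| ≤ CT₄`) and
  «|log η| ≥ K₁K₂» (`hη`). The ζ = 1 twin is file 9's `FeynmanGauge.dressingFactor_le_one_feynman`.
* §7 (v1.3) **Lemma VI.1 (VI.5) in file 2's typed form, reduced BY NAME to (VI.14) + (III.7)**: `dressingFactor_le_one_crossReg_uniform`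
  ((VI.35) with `K₁, K₂` chosen before the background direction `t` — `lemmaVI2_crossReg` is uniform in `t`), and
  **`lemmaVI1Printed_cross_of_representation`** (`0 < ζ ≤ 1`; `_cross_homothetic_of_representation` at ζ = 3/13): `Stability.LemmaVI1Printed D`
  holds for EVERY dressing-factor datum `D` whose `g` admits, for `η` below some `η₁ > 0` and all `(i, α, x, y)`, the printed representation (VI.14) with
  the cross-ordered homothetic integrand `crossFReg` (direction `t ∈ [0,1]`, `|Δ| ≥ 0`, `0 ≤ κ(v) ≤ 1`, integrability, `g > 0`) and (III.7) as
  invoked (`|log η| ≤ CT₄`, «η small enough» p.352) — with `η₀ = min(½, η₁/2, e^{−K₁K₂})`. The paper's proof of Lemma VI.1 uses nothing else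
  (p.374 L17–27).

**Readings (declared).** (i) The BF of (VI.9) is taken in the CROSS (covariant, (A.27)/p.357) order of the `(1 − ζ)`-blocks — the ordering for
which App. 1's transfer holds (file 18); for the literal display order the determinant changes sign (file 17) and nothing is claimed. (ii) At
`κ = 0`, `β > 0` (outside the image of p.372's `β = κx²`) the integrand is the continuous extension in `(√(βκ), β)`; Lemma VI.2 is uniform in
`κ ∈ [0,1]` as printed. (iii) `K₁, K₂` exist by compactness (the paper's «(large…) constants»); no explicit values. (iv) `ζ = 0` is excluded
(`w = ζ⁻¹`).

**Finding (o) closed.** File 19 v1.1's `lemmaVI2_cross_of_smallBeta` has an unsatisfiable hypothesis because of the `κ = 0` junk of `crossF`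
(file 20 header); `lemmaVI2_cross_pos` here is the honest replacement on `κ > 0`, `lemmaVI2_crossReg` the uniform statement.

**What is NOT claimed.** Lemma VI.2 for the literal ordering of (VI.9); which ordering the authors intend; that MRS's own dressing factor
`g_{i,α,Δ}` of (VI.1) satisfies the representation hypothesis `hrep` of §7 — that is (VI.14) p.372, a functional-determinant identity
(the log-determinant identity for the cut-off operators `FP`, `BF` on a cube — our gloss, not a printed phrase) NOT formalised anywhere in the tree — nor (III.7) itself (typed elsewhere as a
named input); so Lemma VI.1 is proved here only RELATIVE to those two printed inputs (§6: one cube / one direction; §7: the typed predicate with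
its printed quantifiers); anything downstream (Sects. VII–VIII); anything of Bałaban's, continuum or T⁴-global; the Clay problem.
-/

noncomputable section

open scoped ComplexOrder MatrixOrder Kronecker
open Complex Matrix Finset

namespace Literature.MathematicalPhysics.QuantumFieldTheory.MagnenRivasseauSeneor1993


namespace CrossLemmaVI2

open FeynmanGauge BosonTrace HomotheticA27 DetTransfer Structure CrossLargeBeta MeasureTheory Set intervalIntegral
open scoped Real

/-- **The determinant «1 + βP(β, κ, t, cosθ, sinφ, ζ, 1/ζ)» of (VI.14) for the cross-ordered homothetic BF in Lemma VI.2's variables**,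
regularised at `κ = 0`: `det BF_reg(ζ, ζ⁻¹; a = √(βκ), b = β; t, n(θ, φ))` with `n = (sinθ sinφ, cosθ, sinθ cosφ, 0)` — equal to file 19's
`crossDet` for `κ > 0` (`crossDetReg_eq_crossDet`) and to its continuous extension at `κ = 0` (where file 19's `√(β/0) = 0` returned `1`).
[cite: MagnenRivasseauSeneor1993, §VI (VI.14) p.372 tl.15–17] -/
def crossDetReg (ζ β κ t θ φ : ℝ) : ℝ :=
  ((BFreg ζ ζ⁻¹ (Real.sqrt (β * κ)) β t (Real.sin θ * Real.sin φ) (Real.cos θ) (Real.sin θ * Real.cos φ) 0).det).re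

/-- The integrand of Lemma VI.2 at gauge parameter `ζ`, cross ordering, regularised dictionary (cf. file 19's `crossIntegrand`):
`ln|1 − βκ[cos²θ + t²sin²θcos²φ]| − ½ ln det BF_reg + (β/2)[6(1 + (1/ζ − 1)/4) − κ(4 + 3(1/ζ − 1)/2)](1 + t²)`.
[cite: MagnenRivasseauSeneor1993, §VI (VI.14) p.372, Lemma VI.2 (VI.20a/b) p.374] -/
def crossIntegrandReg (ζ β κ t θ φ : ℝ) : ℝ :=
  Real.log |1 - β * κ * (Real.cos θ ^ 2 + t ^ 2 * Real.sin θ ^ 2 * Real.cos φ ^ 2)| -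
    (1 / 2) * Real.log (crossDetReg ζ β κ t θ φ) + (β / 2) * OneLoop.countertermFirstOrder ζ κ * (1 + t ^ 2)

/-- Its angular average — the left side `F(β, κ, t, ζ)` of Lemma VI.2 for the cross ordering (regularised).
[cite: MagnenRivasseauSeneor1993, §VI Lemma VI.2 (VI.20a/b) p.374] -/
def crossFReg (β κ t ζ : ℝ) : ℝ := angAvg (crossIntegrandReg ζ β κ t)

/-- `κ·√(β/κ) = √(βκ)` and `κ·(√(β/κ))² = β` for `κ > 0`, `β ≥ 0`: the dictionary of p.372 in the regularised variables. [cite: MagnenRivasseauSeneor1993, §VI p.372 tl.15–17] -/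
theorem dict_sqrt {β κ : ℝ} (hβ : 0 ≤ β) (hκ : 0 < κ) :
    κ * xOf β κ = Real.sqrt (β * κ) ∧ κ * xOf β κ ^ 2 = β := by
  have hX2 : xOf β κ ^ 2 = β / κ := Real.sq_sqrt (div_nonneg hβ hκ.le)
  constructor
  · have h1 : 0 ≤ κ * xOf β κ := mul_nonneg hκ.le (Real.sqrt_nonneg _)
    rw [eq_comm, Real.sqrt_eq_iff_mul_self_eq (mul_nonneg hβ hκ.le) h1]
    have : κ * xOf β κ * (κ * xOf β κ) = κ ^ 2 * xOf β κ ^ 2 := by ring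
    rw [this, hX2]; field_simp
  · rw [hX2]; field_simp

/-- **For `κ > 0` the regularised determinant IS file 19's `crossDet`** (`0 < ζ`, `β ≥ 0`). [cite: MagnenRivasseauSeneor1993, §VI (VI.14) p.372] -/
theorem crossDetReg_eq_crossDet {ζ β κ : ℝ} (hζ : 0 < ζ) (hβ : 0 ≤ β) (hκ : 0 < κ) (t θ φ : ℝ) :
    crossDetReg ζ β κ t θ φ = crossDet ζ β κ t θ φ := by
  obtain ⟨h1, h2⟩ := dict_sqrt hβ hκ
  unfold crossDetReg crossDet
  rw [BF12Cross_dict (mul_inv_cancel₀ hζ.ne'), h1, h2]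

/-- Hence for `κ > 0` the regularised integrand and angular average are file 19's. [cite: MagnenRivasseauSeneor1993, §VI Lemma VI.2 p.374] -/
theorem crossFReg_eq_crossF {ζ β κ : ℝ} (hζ : 0 < ζ) (hβ : 0 ≤ β) (hκ : 0 < κ) (t : ℝ) :
    crossFReg β κ t ζ = crossF β κ t ζ := by
  unfold crossFReg crossF
  congr 1
  funext θ φ
  simp only [crossIntegrandReg, crossIntegrand, crossDetReg_eq_crossDet hζ hβ hκ]

/-- `a ↦ BF_reg(a, b)` is continuous (affine). [cite: MagnenRivasseauSeneor1993, §VI p.372 tl.8] -/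
theorem continuous_BFreg_fst (ζ w b t n₀ n₁ n₂ n₃ : ℝ) : Continuous fun a : ℝ => BFreg ζ w a b t n₀ n₁ n₂ n₃ := by
  unfold BFreg
  exact (continuous_const.add (Complex.continuous_ofReal.smul continuous_const)).add continuous_const

/-- `(t, n) ↦ BF_reg(a, b; t, n)` is continuous (polynomial). [cite: MagnenRivasseauSeneor1993, §VI p.372 tl.8] -/
theorem continuous_BFreg_par (ζ w a b : ℝ) :
    Continuous fun p : ℝ × ℝ × ℝ × ℝ × ℝ => BFreg ζ w a b p.1 p.2.1 p.2.2.1 p.2.2.2.1 p.2.2.2.2 := by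
  have hA := (continuous_A1 (ζ := ζ) (w := w)).matrix_map Complex.continuous_ofReal
  have hB := (continuous_B2 (ζ := ζ) (w := w)).matrix_map Complex.continuous_ofReal
  unfold BFreg
  exact (continuous_const.add ((hA.const_smul I).const_smul (a : ℂ))).add (hB.const_smul (b : ℂ))

/-- Continuity of `κ ↦ det BF_reg(√(βκ), β)` (polynomial in `√(βκ)`). [cite: MagnenRivasseauSeneor1993, §VI p.372 tl.8] -/
theorem continuous_crossDetReg_kappa (ζ β t θ φ : ℝ) : Continuous fun κ => crossDetReg ζ β κ t θ φ := by
  have h := (continuous_BFreg_fst ζ ζ⁻¹ β t (Real.sin θ * Real.sin φ) (Real.cos θ) (Real.sin θ * Real.cos φ) 0).comp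
    (Real.continuous_sqrt.comp (continuous_const.mul continuous_id) : Continuous fun κ : ℝ => Real.sqrt (β * κ))
  unfold crossDetReg
  exact Complex.continuous_re.comp h.matrix_det

/-- Continuity of the regularised determinant in the angles. [cite: MagnenRivasseauSeneor1993, §VI (VI.14) p.372] -/
theorem continuous_crossDetReg_angles (ζ β κ t : ℝ) : Continuous fun q : ℝ × ℝ => crossDetReg ζ β κ t q.1 q.2 := by
  have hp : Continuous fun q : ℝ × ℝ =>
      ((t, Real.sin q.1 * Real.sin q.2, Real.cos q.1, Real.sin q.1 * Real.cos q.2, (0 : ℝ)) : ℝ × ℝ × ℝ × ℝ × ℝ) := by fun_prop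
  have h := (continuous_BFreg_par ζ ζ⁻¹ (Real.sqrt (β * κ)) β).comp hp
  unfold crossDetReg
  exact Complex.continuous_re.comp h.matrix_det

/-- **The determinant transfer of App. 1 p.383 in Lemma VI.2's variables, down to `κ = 0`**: for `0 < ζ ≤ 1`, `β ≥ 0`, `0 ≤ κ ≤ 1`,
`0 ≤ t ≤ 1`: `ζ⁹·S(β, κ, t, θ, φ)⁴ ≤ det BF_reg(√(βκ), β)` (`S` = file 9's (VI.15)/(A.6) cubic); at `κ = 0` by continuity in `κ`.
[cite: MagnenRivasseauSeneor1993, App. 1 p.383 tl.1–7; §VI (VI.14)–(VI.15) p.372] -/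
theorem det_transfer_reg {ζ β κ t : ℝ} (hζ0 : 0 < ζ) (hζ1 : ζ ≤ 1) (hβ : 0 ≤ β) (hκ0 : 0 ≤ κ) (hκ1 : κ ≤ 1) (θ φ : ℝ) :
    ζ ^ 9 * feynmanCubic β κ t θ φ ^ 4 ≤ crossDetReg ζ β κ t θ φ := by
  -- κ > 0: file 18's transfer through the dictionary
  have hpos : ∀ κ' : ℝ, 0 < κ' → κ' ≤ 1 → ζ ^ 9 * feynmanCubic β κ' t θ φ ^ 4 ≤ crossDetReg ζ β κ' t θ φ := by
    intro κ' hκ' hκ'1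
    have hsph := sphere_angles θ φ
    have hw : ζ * ζ⁻¹ = 1 := mul_inv_cancel₀ hζ0.ne'
    have hle := det_transfer (x := xOf β κ') (y := t * xOf β κ') hζ0 hζ1 hw hκ'.le hκ'1 hsph
    have h1 := (Complex.le_def.1 hle).1
    rw [det_M3_dict hβ hκ', ← Complex.ofReal_pow, ← Complex.ofReal_pow, ← Complex.ofReal_mul, Complex.ofReal_re] at h1
    rwa [crossDetReg_eq_crossDet hζ0 hβ hκ']
  rcases hκ0.eq_or_lt with h0 | hpos0
  · -- κ = 0: limit κ' → 0⁺
    subst h0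
    have hcont : Continuous fun κ' => crossDetReg ζ β κ' t θ φ - ζ ^ 9 * feynmanCubic β κ' t θ φ ^ 4 := by
      refine (continuous_crossDetReg_kappa ζ β t θ φ).sub ?_
      unfold feynmanCubic
      fun_prop
    have htend : Filter.Tendsto (fun κ' => crossDetReg ζ β κ' t θ φ - ζ ^ 9 * feynmanCubic β κ' t θ φ ^ 4)
        (nhdsWithin 0 (Set.Ioi 0)) (nhds (crossDetReg ζ β 0 t θ φ - ζ ^ 9 * feynmanCubic β 0 t θ φ ^ 4)) :=
      (hcont.tendsto 0).mono_left nhdsWithin_le_nhds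
    have hev : ∀ᶠ κ' in nhdsWithin (0 : ℝ) (Set.Ioi 0),
        (0 : ℝ) ≤ crossDetReg ζ β κ' t θ φ - ζ ^ 9 * feynmanCubic β κ' t θ φ ^ 4 := by
      filter_upwards [Ioo_mem_nhdsGT (zero_lt_one' ℝ)] with κ' hκ'
      linarith [hpos κ' hκ'.1 hκ'.2.le]
    have := ge_of_tendsto htend hev
    linarith
  · exact hpos κ hpos0 hκ1

/-- **Pointwise transfer on the open square for ALL `0 ≤ κ ≤ 1`** (cf. file 19's `crossIntegrand_le_feynman`, `κ > 0` only).
[cite: MagnenRivasseauSeneor1993, §VI Lemma VI.2 (VI.20a) p.374; App. 1 p.383 tl.3–7] -/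
theorem crossIntegrandReg_le_feynman {ζ β κ t : ℝ} (hζ0 : 0 < ζ) (hζ1 : ζ ≤ 1) (hβ : 0 < β) (hκ0 : 0 ≤ κ) (hκ1 : κ ≤ 1)
    (ht0 : 0 ≤ t) (ht1 : t ≤ 1) {θ φ : ℝ} (hθ : θ ∈ Ioo (0 : ℝ) π) (hφ : φ ∈ Ioo (0 : ℝ) π) :
    crossIntegrandReg ζ β κ t θ φ ≤ feynmanIntegrand β κ t θ φ + (9 / 2) * Real.log (1 / ζ) + (3 / 2) * (1 / ζ - 1) * β := by
  have hsθ : 0 < Real.sin θ := Real.sin_pos_of_pos_of_lt_pi hθ.1 hθ.2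
  have hsφ : 0 < Real.sin φ := Real.sin_pos_of_pos_of_lt_pi hφ.1 hφ.2
  have hS : 0 < feynmanCubic β κ t θ φ :=
    lt_of_lt_of_le (by positivity) (feynmanCubic_ge β κ t θ φ hβ.le hκ1 ht0 ht1)
  have htr := det_transfer_reg (t := t) hζ0 hζ1 hβ.le hκ0 hκ1 θ φ
  have hpos' : 0 < ζ ^ 9 * feynmanCubic β κ t θ φ ^ 4 := by positivity
  have hlog : Real.log (ζ ^ 9 * feynmanCubic β κ t θ φ ^ 4) ≤ Real.log (crossDetReg ζ β κ t θ φ) := Real.log_le_log hpos' htr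
  rw [Real.log_mul (pow_pos hζ0 9).ne' (pow_pos hS 4).ne', Real.log_pow, Real.log_pow] at hlog
  have hbr : (β / 2) * OneLoop.countertermFirstOrder ζ κ * (1 + t ^ 2) ≤
      (β / 2) * (6 - 4 * κ) * (1 + t ^ 2) + (3 / 2) * (1 / ζ - 1) * β := by
    have hwz : 0 ≤ 1 / ζ - 1 := by rw [sub_nonneg, le_div_iff₀ hζ0]; linarith
    have ht2 : t ^ 2 ≤ 1 := by nlinarith
    unfold OneLoop.countertermFirstOrder
    nlinarith [mul_nonneg hwz hκ0, mul_nonneg hβ.le hwz, mul_nonneg (mul_nonneg hβ.le hwz) (sq_nonneg t),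
      mul_nonneg (mul_nonneg hβ.le hwz) hκ0, mul_nonneg (mul_nonneg (mul_nonneg hβ.le hwz) hκ0) (sq_nonneg t)]
  have hlz : Real.log (1 / ζ) = -Real.log ζ := by rw [one_div, Real.log_inv]
  unfold crossIntegrandReg feynmanIntegrand onePlusBetaP_feynmanDet
  rw [Real.log_pow]
  push_cast at hlog ⊢
  linarith

/-- `x ln x ≥ −1` for `x ≥ 0`. [folklore] -/
private theorem mul_log_ge_neg_one {x : ℝ} (hx0 : 0 ≤ x) : -1 ≤ x * Real.log x := by
  rcases hx0.eq_or_lt with h | h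
  · rw [← h]; simp
  · have hlog := Real.one_sub_inv_le_log_of_pos h
    have hx : x * (1 - x⁻¹) = x - 1 := by field_simp
    have := mul_le_mul_of_nonneg_left hlog h.le
    rw [hx] at this
    linarith

/-- `∫₀^π sinφ (c − 4 ln sinφ) dφ = 2c − 4∫₀^π sinφ ln sinφ dφ` (as in file 9). [folklore] -/
private theorem integral_sin_mul_const_sub_log (c : ℝ) :
    ∫ φ in (0 : ℝ)..π, Real.sin φ * (c - 4 * Real.log (Real.sin φ)) =
      2 * c - 4 * ∫ φ in (0 : ℝ)..π, Real.sin φ * Real.log (Real.sin φ) := by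
  have hsplit : (fun φ => Real.sin φ * (c - 4 * Real.log (Real.sin φ))) =
      fun φ => c * Real.sin φ - 4 * (Real.sin φ * Real.log (Real.sin φ)) := by
    funext φ; ring
  have i1 : IntervalIntegrable (fun φ => c * Real.sin φ) volume 0 π :=
    (by fun_prop : Continuous fun φ => c * Real.sin φ).intervalIntegrable _ _
  have i2 : IntervalIntegrable (fun φ => 4 * (Real.sin φ * Real.log (Real.sin φ))) volume 0 π :=
    (continuous_const.mul (Real.continuous_mul_log.comp Real.continuous_sin)).intervalIntegrable _ _
  rw [hsplit, integral_sub i1 i2, intervalIntegral.integral_const_mul, intervalIntegral.integral_const_mul,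
    OneLoop.integral_sin_zero_pi]
  ring

/-- `−π ≤ ∫₀^π sinφ ln sinφ dφ` and `−π ≤ ∫₀^π sin²θ ln sinθ dθ` (as in file 9). [folklore] -/
private theorem integral_sin_mul_log_sin_ge :
    -π ≤ ∫ φ in (0 : ℝ)..π, Real.sin φ * Real.log (Real.sin φ) ∧
      -π ≤ ∫ θ in (0 : ℝ)..π, Real.sin θ ^ 2 * Real.log (Real.sin θ) := by
  have hπ : (0 : ℝ) ≤ π := Real.pi_pos.le
  have hc1 : Continuous fun φ => Real.sin φ * Real.log (Real.sin φ) :=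
    Real.continuous_mul_log.comp Real.continuous_sin
  have hc2 : Continuous fun θ => Real.sin θ ^ 2 * Real.log (Real.sin θ) := by
    have : (fun θ => Real.sin θ ^ 2 * Real.log (Real.sin θ)) =
        fun θ => Real.sin θ * (Real.sin θ * Real.log (Real.sin θ)) := by funext θ; ring
    rw [this]
    exact Real.continuous_sin.mul hc1
  have hconst : ∫ _ in (0 : ℝ)..π, (-1 : ℝ) = -π := by simp
  constructor
  · rw [← hconst]
    apply integral_mono_on hπ (by simp) (hc1.intervalIntegrable _ _)
    intro φ hφ
    exact mul_log_ge_neg_one (Real.sin_nonneg_of_nonneg_of_le_pi hφ.1 hφ.2)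
  · rw [← hconst]
    apply integral_mono_on hπ (by simp) (hc2.intervalIntegrable _ _)
    intro θ hθ
    have hs0 := Real.sin_nonneg_of_nonneg_of_le_pi hθ.1 hθ.2
    have hs1 := Real.sin_le_one θ
    have h := mul_log_ge_neg_one hs0
    have key := mul_nonneg hs0 (show 0 ≤ Real.sin θ * Real.log (Real.sin θ) + 1 by linarith)
    have : Real.sin θ ^ 2 * Real.log (Real.sin θ) =
        Real.sin θ * (Real.sin θ * Real.log (Real.sin θ) + 1) - Real.sin θ := by ring
    rw [this]
    linarith

/-- `⟨c − 4 ln sinθ − 4 ln sinφ⟩ ≤ c + 2π + 8` (as in file 9). [folklore] -/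
private theorem angAvg_logMajorant_le (c : ℝ) :
    angAvg (fun θ φ => c - 4 * Real.log (Real.sin θ) - 4 * Real.log (Real.sin φ)) ≤ c + 2 * π + 8 := by
  unfold angAvg
  obtain ⟨hJ₀ge, hJ₂ge⟩ := integral_sin_mul_log_sin_ge
  set J₀ := ∫ φ in (0 : ℝ)..π, Real.sin φ * Real.log (Real.sin φ) with hJ₀
  set J₂ := ∫ θ in (0 : ℝ)..π, Real.sin θ ^ 2 * Real.log (Real.sin θ) with hJ₂
  have hinner : ∀ θ : ℝ, (∫ φ in (0 : ℝ)..π, Real.sin φ * (c - 4 * Real.log (Real.sin θ) - 4 * Real.log (Real.sin φ))) =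
      2 * (c - 4 * Real.log (Real.sin θ)) - 4 * J₀ := fun θ => integral_sin_mul_const_sub_log _
  simp_rw [hinner]
  have hsplit : (fun θ => Real.sin θ ^ 2 * (1 / 2 * (2 * (c - 4 * Real.log (Real.sin θ)) - 4 * J₀))) =
      fun θ => (c - 2 * J₀) * Real.sin θ ^ 2 - 4 * (Real.sin θ ^ 2 * Real.log (Real.sin θ)) := by
    funext θ; ring
  have hc2 : Continuous fun θ => Real.sin θ ^ 2 * Real.log (Real.sin θ) := by
    have : (fun θ => Real.sin θ ^ 2 * Real.log (Real.sin θ)) =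
        fun θ => Real.sin θ * (Real.sin θ * Real.log (Real.sin θ)) := by funext θ; ring
    rw [this]
    exact Real.continuous_sin.mul (Real.continuous_mul_log.comp Real.continuous_sin)
  have i1 : IntervalIntegrable (fun θ => (c - 2 * J₀) * Real.sin θ ^ 2) volume 0 π :=
    (by fun_prop : Continuous fun θ => (c - 2 * J₀) * Real.sin θ ^ 2).intervalIntegrable _ _
  have i2 : IntervalIntegrable (fun θ => 4 * (Real.sin θ ^ 2 * Real.log (Real.sin θ))) volume 0 π :=
    (continuous_const.mul hc2).intervalIntegrable _ _
  rw [hsplit, integral_sub i1 i2, intervalIntegral.integral_const_mul, intervalIntegral.integral_const_mul,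
    OneLoop.integral_sin_sq_zero_pi]
  have hπ0 : 0 < π := Real.pi_pos
  have hJ₂' : (∫ θ in (0 : ℝ)..π, Real.sin θ ^ 2 * Real.log (Real.sin θ)) = J₂ := rfl
  rw [hJ₂']
  rw [show 2 / π * ((c - 2 * J₀) * (π / 2) - 4 * J₂) = c - 2 * J₀ - 8 / π * J₂ by field_simp; ring]
  have h8 : -(8 / π * J₂) ≤ 8 := by
    have : 8 / π * (-J₂) ≤ 8 / π * π := mul_le_mul_of_nonneg_left (by linarith) (by positivity)
    have h' : 8 / π * π = 8 := by field_simp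
    linarith
  linarith


/-- **(H3)-type bound from any threshold `0 < a ≤ 1/4`** for the regularised cross form (all `0 ≤ κ ≤ 1`, no case split):
`F_ζ(β, κ, t) ≤ (7 + (3/2)(1/ζ − 1))β − 2ln(4a) + (9/2)ln(1/ζ) + 2π + 8` for `β ≥ a`. [cite: MagnenRivasseauSeneor1993, §VI p.374 tl.6–8, Lemma VI.2 (VI.20a) p.374] -/
theorem crossFReg_le_largeBeta_from {ζ a β κ t : ℝ} (hζ0 : 0 < ζ) (hζ1 : ζ ≤ 1) (ha : 0 < a) (ha4 : a ≤ 1 / 4) (haβ : a ≤ β)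
    (hκ0 : 0 ≤ κ) (hκ1 : κ ≤ 1) (ht0 : 0 ≤ t) (ht1 : t ≤ 1) :
    crossFReg β κ t ζ ≤ (7 + (3 / 2) * (1 / ζ - 1)) * β - 2 * Real.log (4 * a) + (9 / 2) * Real.log (1 / ζ) + 2 * π + 8 := by
  have hβ : 0 < β := ha.trans_le haβ
  have hwz : 0 ≤ 1 / ζ - 1 := by rw [sub_nonneg, le_div_iff₀ hζ0]; linarith
  have hlz : 0 ≤ Real.log (1 / ζ) := Real.log_nonneg (by rw [le_div_iff₀ hζ0]; linarith)
  have hla : 0 ≤ -(2 * Real.log (4 * a)) := by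
    have := Real.log_nonpos (by linarith : 0 ≤ 4 * a) (by linarith : 4 * a ≤ 1)
    linarith
  unfold crossFReg
  have hlogsin : ∀ x : ℝ, Real.log (Real.sin x) ≤ 0 := fun x => by
    rw [← Real.log_abs]
    exact Real.log_nonpos (abs_nonneg _) (Real.abs_sin_le_one x)
  set c := (7 + (3 / 2) * (1 / ζ - 1)) * β - 2 * Real.log (4 * a) + (9 / 2) * Real.log (1 / ζ) with hc
  have hc0 : 0 ≤ c := by
    rw [hc]; nlinarith [mul_nonneg hβ.le hwz, hβ.le]
  have hmono : angAvg (crossIntegrandReg ζ β κ t) ≤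
      angAvg (fun θ φ => c - 4 * Real.log (Real.sin θ) - 4 * Real.log (Real.sin φ)) := by
    apply angAvg_le_of_le_Ioo
    · intro θ _
      have : (fun φ => Real.sin φ * (c - 4 * Real.log (Real.sin θ) - 4 * Real.log (Real.sin φ))) =
          fun φ => (c - 4 * Real.log (Real.sin θ)) * Real.sin φ - 4 * (Real.sin φ * Real.log (Real.sin φ)) := by
        funext φ; ring
      rw [this]
      exact ((continuous_const.mul Real.continuous_sin).sub
        (continuous_const.mul (Real.continuous_mul_log.comp Real.continuous_sin))).intervalIntegrable _ _
    · have hJ : ∀ θ : ℝ, (∫ φ in (0 : ℝ)..π, Real.sin φ *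
          (c - 4 * Real.log (Real.sin θ) - 4 * Real.log (Real.sin φ))) =
          2 * (c - 4 * Real.log (Real.sin θ)) - 4 * ∫ φ in (0 : ℝ)..π, Real.sin φ * Real.log (Real.sin φ) :=
        fun θ => integral_sin_mul_const_sub_log _
      simp_rw [hJ]
      have : (fun θ => Real.sin θ ^ 2 * (1 / 2 * (2 * (c - 4 * Real.log (Real.sin θ)) -
          4 * ∫ φ in (0 : ℝ)..π, Real.sin φ * Real.log (Real.sin φ)))) =
          fun θ => (c - 2 * ∫ φ in (0 : ℝ)..π, Real.sin φ * Real.log (Real.sin φ)) *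
            Real.sin θ ^ 2 - 4 * (Real.sin θ * (Real.sin θ * Real.log (Real.sin θ))) := by
        funext θ; ring
      rw [this]
      exact ((continuous_const.mul (Real.continuous_sin.pow 2)).sub (continuous_const.mul
        (Real.continuous_sin.mul (Real.continuous_mul_log.comp Real.continuous_sin)))).intervalIntegrable _ _
    · intro θ hθ φ hφ
      have h1 := crossIntegrandReg_le_feynman hζ0 hζ1 hβ hκ0 hκ1 ht0 ht1 hθ hφ
      have h2 := feynmanIntegrand_le_largeBeta ha haβ hκ0 hκ1 ht0 ht1 hθ hφ
      rw [hc]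
      linarith
    · intro θ φ
      linarith [hlogsin θ, hlogsin φ, hc0]
  have hbound := angAvg_logMajorant_le c
  linarith

/-- (H3) from any threshold for the regularised cross form: `Stability.LargeBetaLinear crossFReg ζ a C′(ζ, a)` (file 19's constant `CLargeFrom`).
[cite: MagnenRivasseauSeneor1993, §VI Lemma VI.2 (VI.20a) p.374] -/
theorem largeBetaLinear_crossReg_from {ζ a : ℝ} (hζ0 : 0 < ζ) (hζ1 : ζ ≤ 1) (ha : 0 < a) (ha4 : a ≤ 1 / 4) :
    Stability.LargeBetaLinear crossFReg ζ a (CLargeFrom ζ a) := by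
  intro β κ t haβ hκ0 hκ1 ht0 ht1
  have h := crossFReg_le_largeBeta_from hζ0 hζ1 ha ha4 haβ hκ0 hκ1 ht0 ht1
  have hβa : 1 ≤ β / a := by rw [le_div_iff₀ ha]; linarith
  have hlz : 0 ≤ Real.log (1 / ζ) := Real.log_nonneg (by rw [le_div_iff₀ hζ0]; linarith)
  have hla : 0 ≤ -(2 * Real.log (4 * a)) := by
    have := Real.log_nonpos (by linarith : 0 ≤ 4 * a) (by linarith : 4 * a ≤ 1)
    linarith
  have hK : 0 ≤ -(2 * Real.log (4 * a)) + (9 / 2) * Real.log (1 / ζ) + 2 * π + 8 := by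
    linarith [Real.pi_pos, mul_nonneg (by norm_num : (0:ℝ) ≤ 9 / 2) hlz]
  have hlin : -(2 * Real.log (4 * a)) + (9 / 2) * Real.log (1 / ζ) + 2 * π + 8 ≤
      (-(2 * Real.log (4 * a)) + (9 / 2) * Real.log (1 / ζ) + 2 * π + 8) / a * β := by
    calc -(2 * Real.log (4 * a)) + (9 / 2) * Real.log (1 / ζ) + 2 * π + 8
        = (-(2 * Real.log (4 * a)) + (9 / 2) * Real.log (1 / ζ) + 2 * π + 8) * 1 := (mul_one _).symm
      _ ≤ (-(2 * Real.log (4 * a)) + (9 / 2) * Real.log (1 / ζ) + 2 * π + 8) * (β / a) := mul_le_mul_of_nonneg_left hβa hK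
      _ = (-(2 * Real.log (4 * a)) + (9 / 2) * Real.log (1 / ζ) + 2 * π + 8) / a * β := by field_simp
  unfold CLargeFrom
  linarith

/-- (H2) from (H3) for the regularised cross form. [cite: MagnenRivasseauSeneor1993, §VI p.374 tl.4–8] -/
theorem middleRangeBound_crossReg_from {ζ a b : ℝ} (hζ0 : 0 < ζ) (hζ1 : ζ ≤ 1) (ha : 0 < a) (ha4 : a ≤ 1 / 4) :
    Stability.MiddleRangeBound crossFReg ζ a b (CLargeFrom ζ a * b) := by
  intro β κ t haβ hβb hκ0 hκ1 ht0 ht1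
  have h := largeBetaLinear_crossReg_from hζ0 hζ1 ha ha4 β κ t haβ hκ0 hκ1 ht0 ht1
  have : CLargeFrom ζ a * β ≤ CLargeFrom ζ a * b := mul_le_mul_of_nonneg_left hβb (CLargeFrom_nonneg hζ0 hζ1 ha ha4)
  linarith

/-! ### The small-β input (H1), PROVED -/

/-- `ln|1 − z| ≤ −z` for `z < 1`. [folklore] -/
private theorem log_abs_one_sub_le' {z : ℝ} (hz : z < 1) : Real.log |1 - z| ≤ -z := by
  have hpos : 0 < 1 - z := by linarith
  rw [abs_of_pos hpos]
  have := Real.log_le_sub_one_of_pos hpos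
  linarith

/-- The constant coefficient of the affine-in-`A` majorant of the small-β regime: (VI.17)'s first order + (VI.16) counterterm bracket + `Cβ²`
(plumbing for (VI.18)). [cite: MagnenRivasseauSeneor1993, §VI (VI.16)–(VI.18) p.373] -/
private def coef0 (ζ C β κ t : ℝ) : ℝ :=
  -(1 / 2) * (β * ((4 + 2 * ζ⁻¹ + 2 * ζ) * (1 + t ^ 2)) +
      (1 / 2) * (β * κ) * ((-4 * ζ⁻¹ + 8 * ζ * ζ⁻¹ - 4 * ζ ^ 2 * ζ⁻¹) * (1 + t ^ 2))) + C * β ^ 2 +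
    (β / 2) * OneLoop.countertermFirstOrder ζ κ * (1 + t ^ 2)

/-- The `A`-coefficient (`A = cos²θ + t²sin²θcos²φ`) of the affine majorant: Faddeev–Popov `−βκ` + (VI.17)'s angular part (plumbing for (VI.18)).
[cite: MagnenRivasseauSeneor1993, §VI (VI.17)–(VI.18) p.373] -/
private def coef1 (ζ β κ : ℝ) : ℝ :=
  -(β * κ) - (1 / 2) * (β * (2 - 2 * ζ⁻¹ - 2 * ζ + 2 * ζ * ζ⁻¹) +
    (1 / 2) * (β * κ) * (-24 + 4 * ζ⁻¹ - 8 * ζ * ζ⁻¹ + 4 * ζ ^ 2 * ζ⁻¹ - 8 * ζ ^ 2 * ζ⁻¹ ^ 2))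

/-- `A(θ, φ) = cos²θ + t²sin²θcos²φ ∈ [0, 1]` for `t ∈ [0, 1]`. [cite: MagnenRivasseauSeneor1993, §VI (VI.18) p.373] -/
theorem angularA_mem {t : ℝ} (ht0 : 0 ≤ t) (ht1 : t ≤ 1) (θ φ : ℝ) :
    0 ≤ Real.cos θ ^ 2 + t ^ 2 * Real.sin θ ^ 2 * Real.cos φ ^ 2 ∧ Real.cos θ ^ 2 + t ^ 2 * Real.sin θ ^ 2 * Real.cos φ ^ 2 ≤ 1 := by
  refine ⟨by positivity, ?_⟩
  have ht2 : t ^ 2 ≤ 1 := by nlinarith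
  have h1 : t ^ 2 * (Real.sin θ ^ 2 * Real.cos φ ^ 2) ≤ Real.sin θ ^ 2 * Real.cos φ ^ 2 :=
    mul_le_of_le_one_left (by positivity) ht2
  have h2 : Real.sin θ ^ 2 * Real.cos φ ^ 2 ≤ Real.sin θ ^ 2 := mul_le_of_le_one_right (sq_nonneg _) (Real.cos_sq_le_one φ)
  nlinarith [Real.cos_sq_add_sin_sq θ]

set_option maxHeartbeats 4000000 in
/-- **(H1) `SmallBetaExpansion` for the cross-ordered homothetic BF, PROVED** (`0 < ζ ≤ 1`): there are `β₀ ∈ (0, 1/4]`, `C ≥ 0` with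
`F_ζ(β, κ, t) ≤ −β/4 + Cβ²` for `0 ≤ β ≤ β₀`, `κ, t ∈ [0,1]` — (VI.17) (boson determinant, `smallBeta_pointwise` + file 10's first order),
the Faddeev–Popov first order `ln|1 − βκA| ≤ −βκA`, the counterterm bracket, the angular average `angAvg_affine_A` and (VI.18)–(VI.19)
(`OneLoop.firstOrder_assembly`): «≅_{β→0} (β/2)(1 + t²)[−3ζ/2 − 1/2 − κ(2 − (3/2)ζ)] + O(β²)» «≤ −(β/4)».
[cite: MagnenRivasseauSeneor1993, §VI (VI.17)–(VI.19) pp.373–374, Lemma VI.2 (VI.20b) p.374] -/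
theorem smallBetaExpansion_crossReg {ζ : ℝ} (hζ0 : 0 < ζ) (hζ1 : ζ ≤ 1) :
    ∃ β₀ C : ℝ, 0 < β₀ ∧ β₀ ≤ 1 / 4 ∧ 0 ≤ C ∧ Stability.SmallBetaExpansion crossFReg ζ β₀ C := by
  have hw0 : 0 < ζ⁻¹ := inv_pos.2 hζ0
  have hw : ζ * ζ⁻¹ = 1 := mul_inv_cancel₀ hζ0.ne'
  obtain ⟨β₀, C, hβ₀, hβ₀4, hC, hpt⟩ := smallBeta_pointwise (ζ := ζ) (w := ζ⁻¹) hw0 hw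
  refine ⟨β₀, C, hβ₀, hβ₀4, hC, ?_⟩
  intro β κ t hβ0 hββ₀ hκ0 hκ1 ht0 ht1
  have ha2 : Real.sqrt (β * κ) ^ 2 = β * κ := Real.sq_sqrt (mul_nonneg hβ0 hκ0)
  have hab : Real.sqrt (β * κ) ^ 2 ≤ β := by rw [ha2]; nlinarith
  have hβκ : β * κ ≤ 1 / 4 := by nlinarith
  -- pointwise bound for every angle, affine in A(θ, φ)
  have hpoint : ∀ θ φ : ℝ, crossIntegrandReg ζ β κ t θ φ ≤
      coef0 ζ C β κ t + coef1 ζ β κ * (Real.cos θ ^ 2 + t ^ 2 * Real.sin θ ^ 2 * Real.cos φ ^ 2) := by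
    intro θ φ
    have hn := sphere_angles θ φ
    obtain ⟨_, hbd⟩ := hpt (Real.sqrt (β * κ)) β t _ _ _ _ ht0 ht1 hn hβ0 hββ₀ hab
    rw [tau1_sphere (ζ := ζ) (w := ζ⁻¹) hn t, tau2_sphere (ζ := ζ) (w := ζ⁻¹) hn t, ha2] at hbd
    obtain ⟨hA0, hA1⟩ := angularA_mem ht0 ht1 θ φ
    have hz : β * κ * (Real.cos θ ^ 2 + t ^ 2 * Real.sin θ ^ 2 * Real.cos φ ^ 2) < 1 := by
      have := mul_le_of_le_one_right (mul_nonneg hβ0 hκ0) hA1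
      linarith
    have hFP := log_abs_one_sub_le' hz
    unfold crossIntegrandReg crossDetReg coef0 coef1
    linarith [hbd, hFP]
  -- continuity of both sides in the angles, then the angular average
  have hdetpos : ∀ θ φ : ℝ, 0 < crossDetReg ζ β κ t θ φ := fun θ φ =>
    (hpt (Real.sqrt (β * κ)) β t _ _ _ _ ht0 ht1 (sphere_angles θ φ) hβ0 hββ₀ hab).1
  have hcontL : Continuous (Function.uncurry (crossIntegrandReg ζ β κ t)) := by
    have hcA : Continuous fun q : ℝ × ℝ =>
        Real.log |1 - β * κ * (Real.cos q.1 ^ 2 + t ^ 2 * Real.sin q.1 ^ 2 * Real.cos q.2 ^ 2)| := by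
      refine Continuous.log (by fun_prop) fun q => ?_
      obtain ⟨hA0, hA1⟩ := angularA_mem ht0 ht1 q.1 q.2
      have := mul_le_of_le_one_right (mul_nonneg hβ0 hκ0) hA1
      rw [abs_ne_zero]
      linarith
    have hcD : Continuous fun q : ℝ × ℝ => Real.log (crossDetReg ζ β κ t q.1 q.2) :=
      (continuous_crossDetReg_angles ζ β κ t).log fun q => (hdetpos q.1 q.2).ne'
    have : Function.uncurry (crossIntegrandReg ζ β κ t) = fun q : ℝ × ℝ =>
        Real.log |1 - β * κ * (Real.cos q.1 ^ 2 + t ^ 2 * Real.sin q.1 ^ 2 * Real.cos q.2 ^ 2)| -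
          (1 / 2) * Real.log (crossDetReg ζ β κ t q.1 q.2) + (β / 2) * OneLoop.countertermFirstOrder ζ κ * (1 + t ^ 2) := by
      funext q; rfl
    rw [this]
    exact (hcA.sub (continuous_const.mul hcD)).add continuous_const
  have hcontR : Continuous (Function.uncurry fun θ φ : ℝ =>
      coef0 ζ C β κ t + coef1 ζ β κ * (Real.cos θ ^ 2 + t ^ 2 * Real.sin θ ^ 2 * Real.cos φ ^ 2)) := by
    have : (Function.uncurry fun θ φ : ℝ =>
        coef0 ζ C β κ t + coef1 ζ β κ * (Real.cos θ ^ 2 + t ^ 2 * Real.sin θ ^ 2 * Real.cos φ ^ 2)) =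
        fun q : ℝ × ℝ => coef0 ζ C β κ t + coef1 ζ β κ * (Real.cos q.1 ^ 2 + t ^ 2 * Real.sin q.1 ^ 2 * Real.cos q.2 ^ 2) := by
      funext q; rfl
    rw [this]; fun_prop
  have hmono := angAvg_mono_of_continuous hcontL hcontR hpoint
  unfold crossFReg
  refine hmono.trans ?_
  rw [angAvg_affine_A]
  -- the first-order identity (VI.18) and the inequality (VI.19)
  have key : coef0 ζ C β κ t + coef1 ζ β κ * (1 + t ^ 2) / 4 =
      β / 2 * (1 + t ^ 2) * (OneLoop.fpFirstOrder κ + OneLoop.bosonFirstOrder ζ κ + OneLoop.countertermFirstOrder ζ κ)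
        + C * β ^ 2 := by
    unfold coef0 coef1 OneLoop.fpFirstOrder OneLoop.bosonFirstOrder OneLoop.countertermFirstOrder
    field_simp
    ring
  rw [key, OneLoop.firstOrder_assembly hζ0.ne' κ]
  have hbr : -3 * ζ / 2 - 1 / 2 - κ * (2 - 3 / 2 * ζ) ≤ -(1 / 2) := by
    have : 0 ≤ κ * (2 - 3 / 2 * ζ) := mul_nonneg hκ0 (by linarith)
    linarith
  have e1 : β / 2 * (1 + t ^ 2) * (-3 * ζ / 2 - 1 / 2 - κ * (2 - 3 / 2 * ζ)) ≤ β / 2 * (1 + t ^ 2) * (-(1 / 2)) :=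
    mul_le_mul_of_nonneg_left hbr (by positivity)
  have e2 : 0 ≤ β * t ^ 2 := by positivity
  linarith

/-- **LEMMA VI.2 (VI.20a/b) FOR THE CROSS-ORDERED HOMOTHETIC BF, every `0 < ζ ≤ 1`, UNCONDITIONAL**: «there exists two (large…) constants
K₁ and K₂ such that [F(β, κ, t, ζ)] ≤ K₂β if β ≥ (K₁)⁻¹ (VI.20a); ≤ −(β/8) if β ≤ (K₁)⁻¹ (VI.20b)» — by file 8's reduction with (H1) =
`smallBetaExpansion_crossReg` (PROVED here), (H3) = `largeBetaLinear_crossReg_from`, (H2) = `middleRangeBound_crossReg_from`. The integrand is the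
regularised `crossFReg` (= file 19's `crossF` for `κ > 0`, `crossFReg_eq_crossF`). [cite: MagnenRivasseauSeneor1993, §VI Lemma VI.2 (VI.20a)–(VI.20b) p.374] -/
theorem lemmaVI2_crossReg {ζ : ℝ} (hζ0 : 0 < ζ) (hζ1 : ζ ≤ 1) :
    ∃ K₁ K₂ : ℝ, 0 < K₁ ∧ 0 < K₂ ∧
      ∀ β κ t : ℝ, 0 ≤ β → 0 ≤ κ → κ ≤ 1 → 0 ≤ t → t ≤ 1 →
        (K₁⁻¹ ≤ β → crossFReg β κ t ζ ≤ K₂ * β) ∧ (β ≤ K₁⁻¹ → crossFReg β κ t ζ ≤ -(β / 8)) := by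
  obtain ⟨β₀, C, hβ₀, hβ₀4, hC, h1⟩ := smallBetaExpansion_crossReg hζ0 hζ1
  set a : ℝ := min β₀ (1 / (8 * C + 1)) with ha
  have ha0 : 0 < a := lt_min hβ₀ (by positivity)
  have ha4 : a ≤ 1 / 4 := (min_le_left _ _).trans hβ₀4
  exact Stability.lemmaVI2_at_of_inputs (F := crossFReg) hβ₀ hC h1 (largeBetaLinear_crossReg_from hζ0 hζ1 ha0 ha4)
    (middleRangeBound_crossReg_from hζ0 hζ1 ha0 ha4)

/-- **Lemma VI.2 at the homothetic gauge `ζ = 3/13` of the construction** (p.332 [PDF 8] L38–40 «a parameter, called λ in [IZ] and ζ in this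
paper, which takes a value close to 3/13»; p.333 L2–3 «vanishes for ζ = 3/13 [IZ]»; p.339 L34 «ζ is the number close to 3/13 defining the
homothetic [gauge]»; p.374 L4–6 «a small interval centered respectively around 3/13 or 13/3»), for the cross-ordered BF — the case the paper
does not compute explicitly (p.373 L15–16 «In the general case we do not attempt the computation of P, but we compute only the integral over θ
and φ of its first order term in β»; App. 1 treats ζ = 1), settled here by second-order perturbation theory of the determinant, the covariant
transfer (A.27)/p.383 of file 18 and compactness. (v1 of this docstring carried two un-printed «quotations» — «closest to 1/4 …» and «we have
not pushed further the computation since …» — withdrawn in v1.1.) [cite: MagnenRivasseauSeneor1993, §VI Lemma VI.2 (VI.20a)–(VI.20b) p.374;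
§II p.332, p.339 tl.34] -/
theorem lemmaVI2_cross_homothetic :
    ∃ K₁ K₂ : ℝ, 0 < K₁ ∧ 0 < K₂ ∧
      ∀ β κ t : ℝ, 0 ≤ β → 0 ≤ κ → κ ≤ 1 → 0 ≤ t → t ≤ 1 →
        (K₁⁻¹ ≤ β → crossFReg β κ t (3 / 13) ≤ K₂ * β) ∧ (β ≤ K₁⁻¹ → crossFReg β κ t (3 / 13) ≤ -(β / 8)) :=
  lemmaVI2_crossReg (by norm_num) (by norm_num)

/-- In file 2's vocabulary: `Stability.LemmaVI2Printed`-shape at each fixed `ζ ∈ (0, 1]` … for `κ > 0` this is file 19's `crossF`: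
the printed Lemma VI.2 conclusion for the cross form and `κ > 0`. [cite: MagnenRivasseauSeneor1993, §VI Lemma VI.2 (VI.20a)–(VI.20b) p.374] -/
theorem lemmaVI2_cross_pos {ζ : ℝ} (hζ0 : 0 < ζ) (hζ1 : ζ ≤ 1) :
    ∃ K₁ K₂ : ℝ, 0 < K₁ ∧ 0 < K₂ ∧
      ∀ β κ t : ℝ, 0 ≤ β → 0 < κ → κ ≤ 1 → 0 ≤ t → t ≤ 1 →
        (K₁⁻¹ ≤ β → crossF β κ t ζ ≤ K₂ * β) ∧ (β ≤ K₁⁻¹ → crossF β κ t ζ ≤ -(β / 8)) := by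
  obtain ⟨K₁, K₂, hK₁, hK₂, h⟩ := lemmaVI2_crossReg hζ0 hζ1
  refine ⟨K₁, K₂, hK₁, hK₂, fun β κ t hβ hκ hκ1 ht0 ht1 => ?_⟩
  have := h β κ t hβ hκ.le hκ1 ht0 ht1
  rwa [crossFReg_eq_crossF hζ0 hβ hκ] at this

/-! ## §6 (v1.1). (VI.35) at the homothetic gauge: Lemma VI.1's printed route with Lemma VI.2 DISCHARGED (cross-ordered BF)

p.374 [PDF 50] L17–27 (image `renders-cmp155/p50_full_s6.png`, crop `p50_VI35_s2.png`): «We can then complete the proof of Lemma VI.1. Indeed we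
write (using the fact that β = κ/v and 0 ≤ κ ≤ 1 and using (III.7)): g_k(x) ≤ exp(|Δ|(x⁴[∫_{v<K₁} K₂βv dv − [∫v dv(β²/24)[…](1 + t²)²]]))
≤ exp(|Δ|x⁴[K₁K₂ − |log η|]) ≤ 1 (VI.35) if, again, we choose the parameter η in Sect. III sufficiently small so that |log η| ≥ K₁K₂. This
achieves the proof of the lemma.» The tree's `Stability.dressingFactor_le_one` (file 2 `MRS93StabilityEstimate`) is that implication,
kernel-checked on named inputs; here its Lemma VI.2 inputs are theorems. -/

/-- **(VI.35) at the homothetic gauge, cross-ordered BF, every `0 < ζ ≤ 1`, with Lemma VI.2 DISCHARGED by `lemmaVI2_crossReg`.** For each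
direction `t ∈ [0,1]` of the background (`y = tx`) there are `K₁, K₂ > 0` such that, for every cube datum `(g, |Δ|, x, η, CT₄, κ(·))`: if
`0 ≤ κ(v) ≤ 1`, the angle-averaged integrand `v ↦ v·F(κ(v)/v, κ(v))` (`F = crossFReg(·, ·, t, ζ)`, `β = κ/v`) is integrable on `(0, ∞)`,
`ln g = |Δ|x⁴(∫₀^∞ vF dv − CT₄)` (the representation (VI.14) in the variables of p.372 — NAMED, not proved), `g > 0`, `|log η| ≤ CT₄` («using
(III.7)» — NAMED) and `K₁K₂ ≤ |log η|`, then `g ≤ 1` — the conclusion (VI.5) of Lemma VI.1 for this cube and background. The ζ = 1 twin is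
file 9's `dressingFactor_le_one_feynman`. [cite: MagnenRivasseauSeneor1993, §VI (VI.35) p.374, Lemma VI.1 (VI.5) p.369, Lemma VI.2 p.374] -/
theorem dressingFactor_le_one_crossReg {ζ : ℝ} (hζ0 : 0 < ζ) (hζ1 : ζ ≤ 1) {t : ℝ} (ht0 : 0 ≤ t) (ht1 : t ≤ 1) :
    ∃ K₁ K₂ : ℝ, 0 < K₁ ∧ 0 < K₂ ∧
      ∀ {g vol x η CT₄ : ℝ} {κ : ℝ → ℝ}, 0 ≤ vol → (∀ v, 0 ≤ κ v ∧ κ v ≤ 1) →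
        IntegrableOn (fun v => v * crossFReg (κ v / v) (κ v) t ζ) (Ioi 0) →
        Real.log g = vol * x ^ 4 * ((∫ v in Ioi 0, v * crossFReg (κ v / v) (κ v) t ζ) - CT₄) →
        0 < g → |Real.log η| ≤ CT₄ → K₁ * K₂ ≤ |Real.log η| → g ≤ 1 := by
  obtain ⟨K₁, K₂, hK₁, hK₂, h⟩ := lemmaVI2_crossReg hζ0 hζ1
  refine ⟨K₁, K₂, hK₁, hK₂, ?_⟩
  intro g vol x η CT₄ κ hvol hκ hint hrep hg hCT hη
  have hK₁inv : 0 ≤ K₁⁻¹ := inv_nonneg.2 hK₁.le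
  refine Stability.dressingFactor_le_one (F := fun β k => crossFReg β k t ζ) hvol hK₁ hK₂.le hκ ?_ ?_ hint hrep hg hCT hη
  · intro β k hk0 hk1 hβ
    exact (h β k t (hK₁inv.trans hβ) hk0 hk1 ht0 ht1).1 hβ
  · intro β k hk0 hk1 hβ0 hβ
    exact (h β k t hβ0 hk0 hk1 ht0 ht1).2 hβ

/-- **(VI.35) at `ζ = 3/13`** (the homothetic gauge of the construction, p.332 L38–40), cross-ordered BF: the instance of
`dressingFactor_le_one_crossReg`. [cite: MagnenRivasseauSeneor1993, §VI (VI.35) p.374, Lemma VI.1 (VI.5) p.369; §II p.332] -/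
theorem dressingFactor_le_one_cross_homothetic {t : ℝ} (ht0 : 0 ≤ t) (ht1 : t ≤ 1) :
    ∃ K₁ K₂ : ℝ, 0 < K₁ ∧ 0 < K₂ ∧
      ∀ {g vol x η CT₄ : ℝ} {κ : ℝ → ℝ}, 0 ≤ vol → (∀ v, 0 ≤ κ v ∧ κ v ≤ 1) →
        IntegrableOn (fun v => v * crossFReg (κ v / v) (κ v) t (3 / 13)) (Ioi 0) →
        Real.log g = vol * x ^ 4 * ((∫ v in Ioi 0, v * crossFReg (κ v / v) (κ v) t (3 / 13)) - CT₄) →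
        0 < g → |Real.log η| ≤ CT₄ → K₁ * K₂ ≤ |Real.log η| → g ≤ 1 :=
  dressingFactor_le_one_crossReg (by norm_num) (by norm_num) ht0 ht1

/-! ## §7 (v1.3). Lemma VI.1 (VI.5) in file 2's typed form, REDUCED BY NAME to the representation (VI.14) and (III.7) — with
Lemma VI.2 discharged and the constants uniform in the background direction `t`

p.369 [PDF 45] tl.14–15 (image `renders-cmp155/p45_full_s6.png`): «For a sufficiently wide ultraviolet cutoff (in the sense of the parameter η
in (II.14) being small) we have: g_{i,α,Δ}(x, y) ≤ 1. (VI.5)» — typed in file 2 as `Stability.LemmaVI1Printed D` (`∃ η₀ > 0, ∀ η ∈ (0, η₀],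
∀ i α x y, D.g η i α x y ≤ 1`). The paper's proof of it (p.374 L17–27) is: the representation (VI.14) of `ln g` + Lemma VI.2 + (III.7) +
the choice `|log η| ≥ K₁K₂`. Since `lemmaVI2_crossReg`'s constants are uniform in `t ∈ [0,1]`, the choice `η₀ = min(½, η₁/2, e^{−K₁K₂})` is
uniform in the background (intersected with the «η small enough» range `η < η₁` of (III.7)), and (VI.5) follows for EVERY dressing-factor datum `D` whose `g` admits the printed representation with the
cross-ordered homothetic integrand and satisfies (III.7) — those two remain NAMED hypotheses (they are functional-integral facts the paper
derives elsewhere: (VI.14) p.372, (III.7) p.352), nothing else is assumed. -/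

/-- **(VI.35) with constants uniform in the background direction.** As `dressingFactor_le_one_crossReg`, but with `K₁, K₂` chosen BEFORE
`t` (they come from `lemmaVI2_crossReg`, which is uniform in `t ∈ [0,1]`). [cite: MagnenRivasseauSeneor1993, §VI (VI.35) p.374, Lemma VI.2 p.374] -/
theorem dressingFactor_le_one_crossReg_uniform {ζ : ℝ} (hζ0 : 0 < ζ) (hζ1 : ζ ≤ 1) :
    ∃ K₁ K₂ : ℝ, 0 < K₁ ∧ 0 < K₂ ∧
      ∀ {t g vol x η CT₄ : ℝ} {κ : ℝ → ℝ}, 0 ≤ t → t ≤ 1 → 0 ≤ vol → (∀ v, 0 ≤ κ v ∧ κ v ≤ 1) →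
        IntegrableOn (fun v => v * crossFReg (κ v / v) (κ v) t ζ) (Ioi 0) →
        Real.log g = vol * x ^ 4 * ((∫ v in Ioi 0, v * crossFReg (κ v / v) (κ v) t ζ) - CT₄) →
        0 < g → |Real.log η| ≤ CT₄ → K₁ * K₂ ≤ |Real.log η| → g ≤ 1 := by
  obtain ⟨K₁, K₂, hK₁, hK₂, h⟩ := lemmaVI2_crossReg hζ0 hζ1
  refine ⟨K₁, K₂, hK₁, hK₂, ?_⟩
  intro t g vol x η CT₄ κ ht0 ht1 hvol hκ hint hrep hg hCT hη
  have hK₁inv : 0 ≤ K₁⁻¹ := inv_nonneg.2 hK₁.le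
  refine Stability.dressingFactor_le_one (F := fun β k => crossFReg β k t ζ) hvol hK₁ hK₂.le hκ ?_ ?_ hint hrep hg hCT hη
  · intro β k hk0 hk1 hβ
    exact (h β k t (hK₁inv.trans hβ) hk0 hk1 ht0 ht1).1 hβ
  · intro β k hk0 hk1 hβ0 hβ
    exact (h β k t hβ0 hk0 hk1 ht0 ht1).2 hβ

/-- **Lemma VI.1 (VI.5), file 2's typed predicate `Stability.LemmaVI1Printed D`, PROVED for every dressing-factor datum `D` that admits
the printed representation (VI.14) with the CROSS-ordered homothetic integrand at a gauge parameter `0 < ζ ≤ 1` and satisfies (III.7)** —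
i.e. Lemma VI.1 REDUCED BY NAME to exactly the two inputs its printed proof (p.374 L17–27) invokes besides Lemma VI.2: `hrep` packages, for
each `η` below some `η₁ > 0` («η small enough», (III.7) p.352), slice pair `(i, α)` and background `(x, y)`, the data of (VI.14) in the variables of p.372 (a direction `t ∈ [0,1]`
— «we can suppose that y ≤ x … y = tx», p.372 L14–17 —, `|Δ| ≥ 0`, the field size `X`, the quartic counterterm `CT₄`, the cutoff profile
`0 ≤ κ(v) ≤ 1`, integrability, `ln g = |Δ|X⁴(∫₀^∞ v·F dv − CT₄)`, `g > 0`) together with (III.7) as invoked (`|log η| ≤ CT₄`). Conclusion: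
`∃ η₀ > 0` (here `η₀ = min(½, η₁/2, e^{−K₁K₂})` with Lemma VI.2's constants) such that `g ≤ 1` for all `η ∈ (0, η₀]`, all `(i, α, x, y)` —
(VI.5) with its printed quantifiers. NOT claimed: that MRS's actual `g_{i,α,Δ}` of (VI.1) satisfies `hrep` (that is (VI.14), a
functional-determinant identity not formalised), nor (III.7) itself; cross ordering only.
[cite: MagnenRivasseauSeneor1993, §VI Lemma VI.1 (VI.5) p.369, (VI.14) p.372, (VI.35) p.374; §III (III.7) p.352] -/
theorem lemmaVI1Printed_cross_of_representation (D : Stability.DressingFactor) {ζ : ℝ} (hζ0 : 0 < ζ) (hζ1 : ζ ≤ 1)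
    {η₁ : ℝ} (hη₁ : 0 < η₁)
    (hrep : ∀ η : ℝ, 0 < η → η < η₁ → ∀ (i α : ℕ) (x y : ℝ),
      ∃ (t vol X CT₄ : ℝ) (κ : ℝ → ℝ), 0 ≤ t ∧ t ≤ 1 ∧ 0 ≤ vol ∧ (∀ v, 0 ≤ κ v ∧ κ v ≤ 1) ∧
        IntegrableOn (fun v => v * crossFReg (κ v / v) (κ v) t ζ) (Ioi 0) ∧
        Real.log (D.g η i α x y) = vol * X ^ 4 * ((∫ v in Ioi 0, v * crossFReg (κ v / v) (κ v) t ζ) - CT₄) ∧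
        0 < D.g η i α x y ∧ |Real.log η| ≤ CT₄) :
    Stability.LemmaVI1Printed D := by
  obtain ⟨K₁, K₂, hK₁, hK₂, h⟩ := dressingFactor_le_one_crossReg_uniform hζ0 hζ1
  set η₀ : ℝ := min (min (1 / 2) (η₁ / 2)) (Real.exp (-(K₁ * K₂))) with hη₀def
  have hη₀pos : 0 < η₀ := lt_min (lt_min (by norm_num) (by positivity)) (Real.exp_pos _)
  refine Stability.lemmaVI1_of_pointwise D hη₀pos ?_
  intro η hη hηle i α x y
  have hη1 : η < 1 :=
    lt_of_le_of_lt (hηle.trans ((min_le_left _ _).trans (min_le_left _ _))) (by norm_num)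
  have hηη₁ : η < η₁ :=
    lt_of_le_of_lt (hηle.trans ((min_le_left _ _).trans (min_le_right _ _))) (by linarith)
  obtain ⟨t, vol, X, CT₄, κ, ht0, ht1, hvol, hκ, hint, hrepr, hg, hCT⟩ := hrep η hη hηη₁ i α x y
  -- `η ≤ e^{−K₁K₂}` ⇒ `log η ≤ −K₁K₂` ⇒ `|log η| ≥ K₁K₂`
  have hlog : Real.log η ≤ -(K₁ * K₂) := by
    have h1 : η ≤ Real.exp (-(K₁ * K₂)) := hηle.trans (min_le_right _ _)
    have := Real.log_le_log hη h1
    rwa [Real.log_exp] at this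
  have hneg : Real.log η < 0 := Real.log_neg hη hη1
  have habs : K₁ * K₂ ≤ |Real.log η| := by
    rw [abs_of_neg hneg]; linarith
  exact h ht0 ht1 hvol hκ hint hrepr hg hCT habs

/-- The instance `ζ = 3/13` of `lemmaVI1Printed_cross_of_representation` (the homothetic gauge of the construction, p.332 L38–40).
[cite: MagnenRivasseauSeneor1993, §VI Lemma VI.1 (VI.5) p.369, (VI.35) p.374; §II p.332] -/
theorem lemmaVI1Printed_cross_homothetic_of_representation (D : Stability.DressingFactor) {η₁ : ℝ} (hη₁ : 0 < η₁)
    (hrep : ∀ η : ℝ, 0 < η → η < η₁ → ∀ (i α : ℕ) (x y : ℝ),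
      ∃ (t vol X CT₄ : ℝ) (κ : ℝ → ℝ), 0 ≤ t ∧ t ≤ 1 ∧ 0 ≤ vol ∧ (∀ v, 0 ≤ κ v ∧ κ v ≤ 1) ∧
        IntegrableOn (fun v => v * crossFReg (κ v / v) (κ v) t (3 / 13)) (Ioi 0) ∧
        Real.log (D.g η i α x y) = vol * X ^ 4 * ((∫ v in Ioi 0, v * crossFReg (κ v / v) (κ v) t (3 / 13)) - CT₄) ∧
        0 < D.g η i α x y ∧ |Real.log η| ≤ CT₄) :
    Stability.LemmaVI1Printed D :=
  lemmaVI1Printed_cross_of_representation D (by norm_num) (by norm_num) hη₁ hrep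

end CrossLemmaVI2

end Literature.MathematicalPhysics.QuantumFieldTheory.MagnenRivasseauSeneor1993
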